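import Literature.NumberTheory.EllipticCurves.CongruenceVisibilityMultiplicativeTwisted
import HarnessLib

/-!
# Visible elements of `Ш(E/K)[p]` from a `p`-congruent curve, VI: the refined certificate shape (pay at `T`, agree elsewhere)

`Proofs`-style file (theorems only: no definition, no new named fact) in topic
`NumberTheory/EllipticCurves`; the user-facing packaging of the series `CongruenceVisibility*.lean`
(cell `b2b-bsdres`, run/shared/lean/b2b/bsd-rank1-residual/, whose HONEST FRAMING applies: the goal
of that cell is to DELETE the COMBINATION-SHAPED residual classes for ALL analytic-rank `≤ 1`
elliptic curves over `ℚ` — "full BSD formula for every rank `≤ 1` curve in class C" assembled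
STRICTLY from published theorems — so that the rank-`≤ 1` remainder becomes exactly the
CONSTRUCTION-SHAPED classes, which are TYPED (missing-input `Prop`s), NOT attempted; this is not
"finishing BSD").

`WeierstrassCurve.exists_sha_ne_zero_of_congr_of_places`: for an odd prime `p`, a
`Γ_K`-isomorphism `θ : E'[p] ⥲ E[p]`, finite sets `T ⊆ S` of finite places (`E, E'` good and
`v ∤ p` outside `S`), `E(K)` finite of order prime to `p`: if the places of `T` are PAID for —
`∏_{v ∈ T} #E'(K_v)[p] · #(𝓞_v/p) < p^{rank E'(K)}`, the local factor of
`CongruenceVisibilityLocalFactors.lean` — and every place of `S \ T` is FREE — (i) `v ∤ p` and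
`E'(K_v)[p] = 0`, or (ii) both curves split multiplicative with `#E(K_v)[p] ≤ p`, or (iii) both
multiplicative with `γ(E) = r²γ(E')` in `K_v` and `μ_p(K_v) = 1` (the comparison theorems of
`CongruenceVisibilityMultiplicative.lean` / `…Twisted.lean`, from Tate's uniformisation) — then
`Ш(E/K)[p] ≠ 0`. `T = S` is the gen-9 count (`exists_sha_ne_zero_of_congr`); `T = ∅` with
`rank E' ≥ 1` is `exists_sha_ne_zero_of_congr_of_rank_of_mult`. Over `ℚ`: a curve with good
reduction at `p` pays `p · #E'(ℚ_p)[p]` at `p` (finite-flat comparison not available in the tree)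
and nothing at its multiplicative primes of the free kinds. Conditional on the two Tate
uniformisation named facts (`hU`, `hU2`; `TateUniformisation.lean`).

References: [CremonaMazur2000] §3, Table 1; [AgasheStein2002] Thm. 3.1, §3.5; [SilvermanATAEC1994]
Ch. V Thm. 3.1, Lemma 5.2, Thm. 5.3, Cor. 5.4; [MazurRubin2004] §2.3.
-/

noncomputable section

open scoped Classical

open NumberField IsDedekindDomain Field

namespace WeierstrassCurve

open Literature.NumberTheory.EllipticCurves Literature.NumberTheory.GaloisRepresentations Field
open NumberField IsDedekindDomain

section Local

variable {K : Type} [Field K] [NumberField K] (W : WeierstrassCurve K) [W.IsElliptic]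
  {p : ℕ} [hp : Fact p.Prime]

/-- **The refined certificate shape in full generality: PAY at the places of `T`, AGREE elsewhere.**
Let `p` be an odd prime, `θ : E'[p] ⥲ E[p]` a `Γ_K`-isomorphism, `S ⊇ T` finite sets of finite
places with `E, E'` of good reduction and `v ∤ p` outside `S`, `E(K)` finite of order prime to
`p`. Suppose (a) `∏_{v ∈ T} #E'(K_v)[p] · #(𝓞_v/p) < p^{rank E'(K)}` (the places one PAYS for, with
the local factor of `CongruenceVisibilityLocalFactors.lean`; e.g. a place `v ∣ p` of GOOD reduction
costs `p^{[K_v:ℚ_p]} · #E'(K_v)[p]`), and (b) every `v ∈ S \ T` is of one of the three free kinds: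
(i) `v ∤ p` and `E'(K_v)[p] = 0`; (ii) both curves split multiplicative at `v` and
`#E(K_v)[p] ≤ p`; (iii) both curves multiplicative at `v`, `γ(E) = r² γ(E')` in `K_v`, and
`μ_p(K_v) = 1`. Then `Ш(E/K)` has a non-zero element killed by `p`. (`exists_sha_ne_zero_of_congr_of_le_off`
with the agreement supplied by `relIndex_map_selmerLocalKer_eq_one_of_card_torsion_eq_one` and the
split / twisted comparison theorems; conditional on the Tate uniformisation facts `hU`, `hU2`.)
With `T = ∅` and `rank E' ≥ 1` this is `exists_sha_ne_zero_of_congr_of_rank_of_mult`; with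
`T = S` it is `exists_sha_ne_zero_of_congr` of `CongruenceVisibilityLocalFactors.lean`.
[cite: CremonaMazur2000, §3 and Table 1] [cite: AgasheStein2002, Thm. 3.1 and §3.5]
[cite: SilvermanATAEC1994, Ch. V Thm. 3.1, Lemma 5.2, Thm. 5.3, Cor. 5.4] -/
theorem exists_sha_ne_zero_of_congr_of_places
    (hU : Silverman1994_thmV53_tateUniformisation.{0})
    (hU2 : Silverman1994_thmV53_corV54_tateUniformisation.{0}) (hp2 : p ≠ 2)
    (W' : WeierstrassCurve K) [W'.IsElliptic]
    (θ : geomTorsion W' (p : ℤ) ≃+ geomTorsion W (p : ℤ))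
    (hθ : ∀ (σ : absoluteGaloisGroup K) (P : geomTorsion W' (p : ℤ)), θ (σ • P) = σ • θ P)
    (S T : Finset (HeightOneSpectrum (𝓞 K))) (hTS : T ⊆ S)
    (hS : ∀ w : HeightOneSpectrum (𝓞 K), w ∉ S →
      W.HasGoodReductionAt w ∧ W'.HasGoodReductionAt w ∧ (p : 𝓞 K) ∉ w.asIdeal)
    (hfin : Finite W.toAffine.Point) (hcop : (Nat.card W.toAffine.Point).Coprime p)
    (hT : (∏ w ∈ T, Nat.card (nsmulAddMonoidHom p :
        (W'.baseChange (w.adicCompletion K)).toAffine.Point →+ _).ker *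
        Nat.card (w.adicCompletionIntegers K ⧸
          Ideal.span {(p : w.adicCompletionIntegers K)})) < p ^ W'.mordellWeilRank)
    (hplaces : ∀ w ∈ S, w ∉ T →
      ((p : 𝓞 K) ∉ w.asIdeal ∧ Nat.card (nsmulAddMonoidHom p :
          (W'.baseChange (w.adicCompletion K)).toAffine.Point →+ _).ker = 1) ∨
      (W.HasSplitMultiplicativeReductionAt w ∧ W'.HasSplitMultiplicativeReductionAt w ∧
        Nat.card (nsmulAddMonoidHom p :
          (W.baseChange (w.adicCompletion K)).toAffine.Point →+ _).ker ≤ p) ∨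
      (W.HasMultiplicativeReductionAt w ∧ W'.HasMultiplicativeReductionAt w ∧
        (∃ r : w.adicCompletion K, algebraMap K (w.adicCompletion K) (-(W.c₄ / W.c₆)) =
          r ^ 2 * algebraMap K (w.adicCompletion K) (-(W'.c₄ / W'.c₆))) ∧
        (∀ ζ : w.adicCompletion K, ζ ^ p = 1 → ζ = 1))) :
    ∃ c : W.sha, c ≠ 0 ∧ p • c = 0 := by
  have hpp : p.Prime := hp.out
  haveI := hfin
  refine exists_sha_ne_zero_of_congr_of_le_off W W' hp2 θ hθ S T hTS hS (fun w hw hwT c hc ↦ ?_) ?_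
  · rcases hplaces w hw hwT with ⟨hwp, hloc⟩ | ⟨hWw, hW'w, hcardw⟩ | ⟨hWw, hW'w, hγw, hμw⟩
    · exact (relIndex_map_selmerLocalKer_eq_one_iff W W' θ hθ).mp
        (relIndex_map_selmerLocalKer_eq_one_of_card_torsion_eq_one W W' θ hθ hwp hloc) c hc
    · exact W.h1Equiv_mem_selmerLocalKer_of_hasSplitMultiplicativeReductionAt w hU W' θ hθ hWw
        hW'w hcardw hc
    · exact W.h1Equiv_mem_selmerLocalKer_of_hasMultiplicativeReductionAt w hU2 hp2 W' θ hθ hWw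
        hW'w hγw hμw hc
  · rw [index_range_zsmul_eq_one_of_coprime hcop, one_mul,
      Finset.prod_congr rfl fun w _ ↦
        (W'.natCard_kummerLocalConditionAt_adicCompletion w hpp.ne_zero)]
    exact lt_of_lt_of_le hT (pow_mordellWeilRank_le_index_range_zsmul W' hpp.ne_zero)

end Local

end WeierstrassCurve

end
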